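import Literature.Geometry.Riemannian.GurskyViaclovskyChartEquationC2
import HarnessLib

/-!
# Entropy rung, Chang–Gursky–Yang crux: the background path equation in a chart for `C²` functions

Helper file for the crux `Summit.SmoothPoincare4.SmoothPoincare4.Theses.EntropyRung.ChangGurskyYang`
(line margerin-cone-hamilton-rails), registered stub `helper_chartEquationC2`: the
Gursky–Viaclovsky background path equation `backgroundPathOperator g t (−u)` read through the
preferred chart at a point `c` of a `4`-manifold is the explicit second-order chart operator
`chartOperator G_c t (|W_g|²) y (DU(y)) (D²U(y))` of the chart representative `U = u ∘ (chartAt c)⁻¹`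
— for `u` of class `C²` (not `C^∞`), the regularity in which the openness half of the continuity
method (implicit function theorem in `C^{2,α}`) and the regularity bootstrap operate. This is the
landed `Literature.Geometry.Riemannian.GurskyViaclovskyPath.backgroundPathOperator_chart_eq_chartOperator`
with its smoothness hypothesis weakened to `ContMDiff … 2 u`; the proof is the Literature lemma
`backgroundPathOperator_chart_eq_chartOperator_of_contMDiff_two`
(`Literature/Geometry/Riemannian/GurskyViaclovskyChartEquationC2.lean`), which re-runs the landed
chain (frame expansion, naturality under the inverse chart, chart dictionary) at order `2` at the
point.

## References

* M. J. Gursky, J. A. Viaclovsky, J. Differential Geom. 63 (2003) 131–154, §1 (change1)–(PDE),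
  Prop. 6. [GurskyViaclovsky2003]
-/

noncomputable section

-- the namespace `…SmoothPoincare4.SmoothPoincare4…` repeats a component by the tree's layout
set_option linter.dupNamespace false

namespace Summit.SmoothPoincare4.SmoothPoincare4.Theorems.MargerinRails

/-- **The background path equation in the preferred chart, for `C²` functions** (registered stub
`helper_chartEquationC2` of the crux `EntropyRung.ChangGurskyYang`, line
margerin-cone-hamilton-rails). For a Riemannian metric `g` with Levi-Civita connection on a
`4`-manifold `M`, `u : M → ℝ` of class `C²`, a point `c` and `y` in the target of the preferred
chart at `c`: with `Φ = (chartAt c)⁻¹ : U → M` on `U = (chartAt c).target` and `G` the components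
of `Φ^*g` (extended by `0` off `U`),
`backgroundPathOperator g t (−u) (Φ y) = chartOperator G t (|W_g|²(Φ y)) y (DU(y)) (D²U(y))`,
`U = u ∘ Φ`. Proof: `backgroundPathOperator_chart_eq_chartOperator_of_contMDiff_two`.
[cite: GurskyViaclovsky2003, §1 (change1)–(PDE) and Prop. 6] -/
theorem helper_chartEquationC2 :
    ∀ (M : Type) [TopologicalSpace M] [ChartedSpace (EuclideanSpace ℝ (Fin 4)) M]
      [IsManifold (modelWithCornersSelf ℝ (EuclideanSpace ℝ (Fin 4))) ((⊤ : ℕ∞) : WithTop ℕ∞) M]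
      (g : Literature.Geometry.Lorentzian.PseudoRiemannianMetric
        (modelWithCornersSelf ℝ (EuclideanSpace ℝ (Fin 4))) ((⊤ : ℕ∞) : WithTop ℕ∞)
        (EuclideanSpace ℝ (Fin 4))
        (TangentSpace (modelWithCornersSelf ℝ (EuclideanSpace ℝ (Fin 4))) : M → Type _))
      [g.HasLeviCivita], g.IsRiemannian → ∀ (t : ℝ) {u : M → ℝ},
      ContMDiff (modelWithCornersSelf ℝ (EuclideanSpace ℝ (Fin 4))) (modelWithCornersSelf ℝ ℝ) 2 u →
      ∀ (c : M) {y : EuclideanSpace ℝ (Fin 4)},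
      y ∈ (chartAt (EuclideanSpace ℝ (Fin 4)) c).target →
      let U : TopologicalSpace.Opens (EuclideanSpace ℝ (Fin 4)) :=
        ⟨(chartAt (EuclideanSpace ℝ (Fin 4)) c).target,
          (chartAt (EuclideanSpace ℝ (Fin 4)) c).open_target⟩
      let Φ : U → M := fun z ↦ (chartAt (EuclideanSpace ℝ (Fin 4)) c).symm z
      let gU := g.comap (Literature.Geometry.Lorentzian.PseudoRiemannianMetric.contMDiff_pullbackBilin_holds)
        Φ (Literature.Geometry.Lorentzian.ChartInverseSelf.contMDiff_symm c)
        (Literature.Geometry.Lorentzian.ChartInverseSelf.injective_mfderiv_symm c) rfl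
      Literature.Geometry.Riemannian.GurskyViaclovskyPath.backgroundPathOperator g t (fun m ↦ -u m)
          ((chartAt (EuclideanSpace ℝ (Fin 4)) c).symm y) =
        Literature.Geometry.Riemannian.GurskyViaclovskyPath.chartOperator
          (Function.extend (Subtype.val : U → EuclideanSpace ℝ (Fin 4))
            (fun z : U ↦ (gU.val z :
              EuclideanSpace ℝ (Fin 4) →L[ℝ] EuclideanSpace ℝ (Fin 4) →L[ℝ] ℝ)) (fun _ ↦ 0))
          t (g.weylNormSq ((chartAt (EuclideanSpace ℝ (Fin 4)) c).symm y)) y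
          (fderiv ℝ (fun z ↦ u ((chartAt (EuclideanSpace ℝ (Fin 4)) c).symm z)) y)
          (fderiv ℝ (fderiv ℝ (fun z ↦ u ((chartAt (EuclideanSpace ℝ (Fin 4)) c).symm z))) y) :=
  fun _M _ _ _ g _ hg t _u hu c _y hy ↦
    Literature.Geometry.Riemannian.GurskyViaclovskyPath.backgroundPathOperator_chart_eq_chartOperator_of_contMDiff_two
      g hg t hu c hy

end Summit.SmoothPoincare4.SmoothPoincare4.Theorems.MargerinRails

end
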